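import Literature.MathematicalPhysics.QuantumFieldTheory.Balaban1983to89.B9Thm31FlatPoincareCoerciveZdPer
import Literature.MathematicalPhysics.QuantumFieldTheory.Balaban1983to89.B9Eq325QGGQInvZdPerLevels
import Literature.MathematicalPhysics.QuantumFieldTheory.Balaban1983to89.B9Eq324NearFlatFormComparisonZdTowerPairs

/-!
# `Balaban1983to89.B9Eq324NearFlatFormComparisonZdPer` — [Balaban1985BackgroundPropagators] (3.23)–(3.24) p. 394 ∕ Thm 3.11 p. 416 ON THE TORUS `T_P` READ ON `ℤᵈ`:
# THE NEAR-FLAT FORM COMPARISON `⟨f, Δ′_a(1)f⟩_{T_P} ≤ 2⟨f, Δ′_a(U₀)f⟩_{T_P} + 2(dθ² + κ)⟨f, f⟩_{T_P}` at a periodic unitary background whose bond variables are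
# `θη`-close to `1` and whose averaged transporters along the tower pairs are `ε_i`-close to `1`, and the TRANSFER OF THE FLAT COERCIVITY: with
# `B9Thm31FlatPoincareCoerciveZdPer`'s `a₀·⟨f,f⟩ ≤ ⟨f, Δ′_a(1)f⟩`, `(a₀∕2 − dθ² − κ)·⟨f, f⟩_{T_P} ≤ ⟨f, Δ′_a(U₀)f⟩_{T_P}` — the scalar regime (`Δ′_a(U₀)` invertible on
# `L²(T_P)`) on an EXPLICIT bond-small class; the periodic twin of `B9Eq324NearFlatFormComparisonZd(TowerPairs)` + `B9Thm31NearFlatCoerciveCubeZd`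

statement-level skeleton of published theorems with citation tags; proofs where landed; nothing here is a claim about the
Yang–Mills mass gap

`[Balaban1985BackgroundPropagators]` ("B9", CMP **99** (1985) 389–434) (3.23)–(3.24) p. 394, (3.18)–(3.19) p. 393, Thm 3.11 p. 416 *«… positive definite … uniformly in U»*,
(3.35) p. 396 (the small-field class).  `[Balaban1985Averaging]` ("B7", CMP **98** (1985) 17–51) (122)–(126) p. 36 (the averaged transporters).  `[Balaban1985RegularSpaces]`
p. 77 *«Ω_j = T_η»*.  PDF held: `paper:balaban1985-cmp99-background-propagators` pp. 393–396, 416.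

CITATION HEADER (lean-in-tree rule).  Cell `pub-ymgap` (YM Track A), DAG node N06 = [B9], width seat `pub-ymgap-dag-n06-w4` (g6), the (β′-PERIODIC) road.  WHY:
`B9Thm311PosDefOpenZdPer` gives the scalar regime `RegularPrimePer L U₀ …` NEAR `U₀ = 1` by openness (no radius); THIS FILE gives it on an EXPLICIT sup-norm class
(bond closeness `θη`, tower-pair transporter closeness `ε_i`) with an EXPLICIT margin, from the flat constant `a₀` of `B9Thm31FlatPoincareCoerciveZdPer` — the torus
reading of this lineage's g5 chain (`…FormComparisonZd(TowerPairs)` → `…NearFlatCoerciveCubeZd`).  The pointwise letters (`fnorm_covDerivFwd_one_sq_le`,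
`fnorm_trIter_sub_flat_le'`, `fnorm_sq_le_two_mul_add`) are imported BY NAME; the only new stencil fact is the LOCALITY of `Q′_j(U₀)` (its value at `y` depends on the
input on the block `Bʲ(y)` only), which frees g5's block-sum identity from its finite-support wrapper.

WHAT IS PROVED (kernel, 0 sorry; theorems only — no `def`, no `instance`, no `notation`).
* §1 `blockSites_pow_subset_succ` (nesting of the tower blocks), ★ `QprimeIter_congr_block` (LOCALITY: `F = G` on `Bʲ(y)` ⟹ `Q′_j(U₀)F(y) = Q′_j(U₀)G(y)`),
  ★ `QprimeIter_eq_blockSum_trIter_fun` (`Q′_j(U₀)F(y) = Σ_{x∈Bʲ(y)} trIter_j(x)(F x)` for ANY site function), ★★ `fnorm_QprimeIter_sub_one_sq_le_fun`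
  (`|(Q′_j(U₀) − Q′_j(1))F(y)|²_τ ≤ (Lᵈ)^{−j}(Σ_{i<j} ε_i)²·Σ_{x∈Bʲ(y)} |F x|²_τ`).
* §2 ★★ `gradEnergy_one_le_per` (`Σ_μΣ_cell |D_1 f|² ≤ 2Σ_μΣ_cell |D_{U₀} f|² + 2dθ²·⟨f,f⟩_{T_P}` for periodic `f` — the shifted cell sum is the cell sum),
  ★★ `penalty_one_le_per` (the averaging term, `Lʲ ∣ P`: the level-`j` blocks tile the cell), ★★★ `formPer_deltaPrimeAPer_one_le_near_flat`
  (`⟨f, Δ′_a(1)f⟩ ≤ 2⟨f, Δ′_a(U₀)f⟩ + 2(dθ² + κ)⟨f, f⟩` on `L²(T_P)`).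
* §3 ★★★ `coercive_near_flat_per` (`(a₀∕2 − dθ² − κ)·⟨f,f⟩ ≤ ⟨f, Δ′_a(U₀)f⟩` on `L²(T_P)` from the flat `a₀`), ★★ `regularPrimePer_near_flat`
  (`a₀∕2 > dθ² + κ` ⟹ `Δ′_a(U₀)` invertible on `L²(T_P)`: THE SCALAR REGIME ON AN EXPLICIT SMALL-FIELD CLASS OF THE TORUS).

HONEST SCOPE.  (i) Scalar operator `Δ′_a` only (not the vector `Δ_a` of the record); explicit constants, L²_τ currency, no decay.  (ii) The class is displayed by BOND
closeness `‖R(U₀(b))a − a‖_τ ≤ θη‖a‖_τ` and TOWER-PAIR transporter closeness — Sect. B's regular-gauge output, NOT derived from the plaquette class (3.35) here (on the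
torus the plaquette class also contains flat backgrounds with holonomy, outside every such sup-norm class — located on the bus).  (iii) Count-neutral; N05 ∕ N06 NOT
discharged; K1⁹ `stmt-QuantumFields-27364` NOT closed; one finite `𝕋⁴` programme at fixed `ε`, Bałaban as printed; R4 closes only the conditional finite-`𝕋⁴` rung
`BalabanLadder.UV` — nothing continuum ∕ ℝ⁴ ∕ OS ∕ mass gap ∕ Clay.  Unit `pub-ymgap-dag-n06-w4` (g6), 2026-08-28.
-/

noncomputable section

namespace Literature.MathematicalPhysics.QuantumFieldTheory.Balaban1983to89.B9Eq324NearFlatFormComparisonZdPer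

open B7Prop1Explicit
open B7Eq78Linearization (conjR conjR_sub conjR_smul_real Qprime Qprime_apply QprimeIter QprimeIter_zero QprimeIter_succ zdBlocking)
open B7Prop2Explicit (unitaryUnits)
open B8Ineq132 (covDerivFwd)
open B8Eq119TwistedAxial (bgT bgT_one)
open Literature.MathematicalPhysics.QuantumLattice (blockMap blockSites mem_blockSites_iff card_blockSites)
open T4TermwiseTorus (IsPeriodic box)
open B9Eq321LandauProjectionZd (suppSub indicator_mem_suppSub)
open B9Eq321LandauProjectionZdPer (perSub formPer formPer_apply)
open B9Eq321LandauOrthogonalZdPer (box_mul_eq_biUnion_blockSites pairwiseDisjoint_blockSites)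
open B9Eq321LandauMultiplierIffZdPer (eq_pow_mul_div_of_dvd)
open B9Eq324DeltaPrimeAZdPer (deltaPrimeAPer RegularPrimePer bijective_of_form_pos)
open B9Eq325QGGQInvZdPerLevels (formPer_deltaPrimeAPer_le)
open B9Eq325QprimeSingleSiteZd (blockMapIter blockMapIter_succ blockMapIter_eq_blockMap_pow trIter trIter_zero trIter_succ)
open B9Eq319QQStarDiagonalZd (mem_blockSites_pow_iff)
open B9Eq342CombesThomasFormZd (fnorm fnorm_nonneg fnorm_sq fnorm_smul fnorm_zero fnorm_add_le fnorm_sum_le)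
open B9Thm31GpDecayOfCoerciveZd (fnorm_conjR_of_unitary fnorm_neg')
open B9Eq324NearFlatFormComparisonZd (fnorm_sq_le_two_mul_add QprimeIter_eq_blockSum_trIter fnorm_covDerivFwd_one_sq_le)
open B9Eq324NearFlatFormComparisonZdTowerPairs (fnorm_trIter_sub_flat_le')
open B9Eq327GreenZdHermPer (sum_box_shift)

-- `Site` alone could resolve to the torus sites of `Setup.lean`; re-export the `ℤ^d` sites of `B7Prop1Explicit`.
export B7Prop1Explicit (Site)

variable {d : ℕ} {𝔸 : Type*} [CStarAlgebra 𝔸]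
variable (τ : 𝔸 →ₗ[ℂ] ℂ) (hτp : ∀ a : 𝔸, a ≠ 0 → 0 < (τ (star a * a)).re)
  (hτt : ∀ a b : 𝔸, τ (a * b) = τ (b * a)) (hτs : ∀ a : 𝔸, τ (star a) = starRingEnd ℂ (τ a))

/-! ## §1  Locality of `Q′_j(U₀)` and the block-sum identity for any site function -/

section Locality

variable {L : ℕ} [NeZero L] {U₀ : Site d → Fin d → 𝔸ˣ}

/-- nesting of the tower blocks: a site of the `Lʲ`-block of an `L`-block site `x` of `y` lies in the `Lʲ⁺¹`-block of `y`. [cite: Balaban1985Averaging, (2)–(3) p.17] -/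
theorem blockSites_pow_subset_succ {j : ℕ} {y x z : Site d} (hx : x ∈ blockSites L y) (hz : z ∈ blockSites (L ^ j) x) : z ∈ blockSites (L ^ (j + 1)) y := by
  rw [mem_blockSites_pow_iff] at hz ⊢
  rw [blockMapIter_succ, hz]
  exact (mem_blockSites_iff L y x).1 hx

/-- ★ **LOCALITY OF THE ITERATED AVERAGING**: `(Q′_j(U₀)F)(y)` depends on `F` only through its values on the block `Bʲ(y)` — if `F = G` there, the averages agree.
[cite: Balaban1985BackgroundPropagators, (3.18)–(3.19) p.393; Balaban1985Averaging, (78) p.30] -/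
theorem QprimeIter_congr_block : ∀ (j : ℕ) (y : Site d) {F G : Site d → 𝔸},
    (∀ z ∈ blockSites (L ^ j) y, F z = G z) → QprimeIter (zdBlocking d L) (bgT L U₀) j F y = QprimeIter (zdBlocking d L) (bgT L U₀) j G y := by
  intro j
  induction j with
  | zero =>
    intro y F G h
    rw [QprimeIter_zero, QprimeIter_zero]
    haveI : NeZero (L ^ 0) := ⟨by simp⟩
    exact h y ((mem_blockSites_iff (L ^ 0) y y).2 (by funext i; simp [blockMap]))
  | succ j ih =>
    intro y F G h
    rw [QprimeIter_succ, QprimeIter_succ, Qprime_apply, Qprime_apply]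
    refine Finset.sum_congr rfl fun x hx => ?_
    have hx' : x ∈ blockSites L y := hx
    rw [ih x fun z hz => h z (blockSites_pow_subset_succ hx' hz)]

/-- ★ **`(Q′_j(U₀)F)(y) = Σ_{x∈Bʲ(y)} trIter_j(x)(F x)` FOR ANY SITE FUNCTION** (g5's `QprimeIter_eq_blockSum_trIter` for finitely supported `f`, freed by locality:
restrict `F` to the block). [cite: Balaban1985BackgroundPropagators, (3.18)–(3.19) p.393; Balaban1985Averaging, (122)–(126) p.36] -/
theorem QprimeIter_eq_blockSum_trIter_fun (F : Site d → 𝔸) (j : ℕ) (y : Site d) :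
    QprimeIter (zdBlocking d L) (bgT L U₀) j F y = ∑ x ∈ blockSites (L ^ j) y, trIter L U₀ j x (F x) := by
  classical
  set B : Finset (Site d) := blockSites (L ^ j) y with hB
  let f : suppSub (𝔸 := 𝔸) B := ⟨(↑B : Set (Site d)).indicator F, indicator_mem_suppSub B F⟩
  have hFG : ∀ z ∈ blockSites (L ^ j) y, F z = (f : Site d → 𝔸) z := fun z hz => (Set.indicator_of_mem (Finset.mem_coe.2 hz) F).symm
  rw [QprimeIter_congr_block j y hFG, QprimeIter_eq_blockSum_trIter U₀ f j y, ← hB]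
  exact Finset.sum_congr rfl fun x hx => by rw [← hFG x hx]

include hτp hτt hτs in
/-- ★★ **THE AVERAGING COMPARISON FOR ANY SITE FUNCTION**: at a background whose averaged transporters along the tower pairs `(blockMap L w, w)` are unitary and
`ε_i`-close to `1` (`i < j`), `|(Q′_j(U₀)F)(y) − (Q′_j(1)F)(y)|²_τ ≤ (Lᵈ)^{−j}·(Σ_{i<j} ε_i)²·Σ_{x∈Bʲ(y)} |F x|²_τ` — g5's `fnorm_QprimeIter_sub_one_sq_le'` without the
support wrapper. [cite: Balaban1985BackgroundPropagators, (3.18)–(3.19) p.393, (3.24) p.394; Balaban1985Averaging, (122)–(126) p.36] -/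
theorem fnorm_QprimeIter_sub_one_sq_le_fun {ε : ℕ → ℝ} (hε : ∀ i, 0 ≤ ε i) (F : Site d → 𝔸) {j : ℕ}
    (hT : ∀ i, i < j → ∀ z y : Site d, bgT L U₀ i z y ∈ unitaryUnits 𝔸)
    (hTε : ∀ i, i < j → ∀ (w : Site d) (b : 𝔸), fnorm τ (conjR (bgT L U₀ i (blockMap L w) w) b - b) ≤ ε i * fnorm τ b) (y : Site d) :
    fnorm τ (QprimeIter (zdBlocking d L) (bgT L U₀) j F y - QprimeIter (zdBlocking d L) (bgT L (1 : Site d → Fin d → 𝔸ˣ)) j F y) ^ 2 ≤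
      (((L : ℝ) ^ d) ^ j)⁻¹ * (∑ i ∈ Finset.range j, ε i) ^ 2 * ∑ x ∈ blockSites (L ^ j) y, fnorm τ (F x) ^ 2 := by
  classical
  set B := blockSites (L ^ j) y with hB
  set c : ℝ := ((L : ℝ) ^ d)⁻¹ with hc
  set E : ℝ := ∑ i ∈ Finset.range j, ε i with hE
  have hc0 : 0 ≤ c := by positivity
  have hE0 : 0 ≤ E := Finset.sum_nonneg fun i _ => hε i
  have hL0 : (0 : ℝ) < (L : ℝ) := by exact_mod_cast Nat.pos_of_ne_zero (NeZero.ne L)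
  have hflat : ∀ x : Site d, trIter L (1 : Site d → Fin d → 𝔸ˣ) j x (F x) = c ^ j • F x := by
    intro x
    have h : ∀ i : ℕ, trIter L (1 : Site d → Fin d → 𝔸ˣ) i x (F x) = c ^ i • F x := by
      intro i
      induction i with
      | zero => rw [trIter_zero, pow_zero, one_smul]
      | succ i ih => rw [trIter_succ, ih, bgT_one, B8Eq191FlatStencils.conjR_unitOne, smul_smul, hc, pow_succ, mul_comm]
    exact h j
  have hdiff : QprimeIter (zdBlocking d L) (bgT L U₀) j F y - QprimeIter (zdBlocking d L) (bgT L (1 : Site d → Fin d → 𝔸ˣ)) j F y =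
      ∑ x ∈ B, (trIter L U₀ j x (F x) - c ^ j • F x) := by
    rw [QprimeIter_eq_blockSum_trIter_fun F j y, QprimeIter_eq_blockSum_trIter_fun F j y, ← hB, ← Finset.sum_sub_distrib]
    exact Finset.sum_congr rfl fun x _ => by rw [hflat x]
  have hpt : ∀ x ∈ B, fnorm τ (trIter L U₀ j x (F x) - c ^ j • F x) ≤ c ^ j * E * fnorm τ (F x) :=
    fun x _ => fnorm_trIter_sub_flat_le' τ hτp hτt hτs x _ j hT hTε
  have h1 : fnorm τ (QprimeIter (zdBlocking d L) (bgT L U₀) j F y - QprimeIter (zdBlocking d L) (bgT L (1 : Site d → Fin d → 𝔸ˣ)) j F y) ≤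
      c ^ j * E * ∑ x ∈ B, fnorm τ (F x) := by
    rw [hdiff]
    refine (fnorm_sum_le hτp hτs _ _).trans ?_
    rw [Finset.mul_sum]
    exact Finset.sum_le_sum hpt
  have h0 : 0 ≤ fnorm τ (QprimeIter (zdBlocking d L) (bgT L U₀) j F y - QprimeIter (zdBlocking d L) (bgT L (1 : Site d → Fin d → 𝔸ˣ)) j F y) :=
    fnorm_nonneg τ _
  have hCS := sq_sum_le_card_mul_sum_sq (s := B) (f := fun x => fnorm τ (F x))
  rw [hB, card_blockSites] at hCS
  push_cast at hCS
  have hcard : (((L : ℝ) ^ j) ^ d) = ((L : ℝ) ^ d) ^ j := by rw [← pow_mul, ← pow_mul, mul_comm]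
  rw [hcard] at hCS
  have hcj : c ^ j * ((L : ℝ) ^ d) ^ j = 1 := by
    rw [hc, inv_pow, inv_mul_cancel₀ (by positivity)]
  calc fnorm τ _ ^ 2 ≤ (c ^ j * E * ∑ x ∈ B, fnorm τ (F x)) ^ 2 := pow_le_pow_left₀ h0 h1 2
    _ = (c ^ j) ^ 2 * E ^ 2 * (∑ x ∈ B, fnorm τ (F x)) ^ 2 := by ring
    _ ≤ (c ^ j) ^ 2 * E ^ 2 * (((L : ℝ) ^ d) ^ j * ∑ x ∈ B, fnorm τ (F x) ^ 2) :=
        mul_le_mul_of_nonneg_left (by rw [hB]; exact hCS) (by positivity)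
    _ = (((L : ℝ) ^ d) ^ j)⁻¹ * E ^ 2 * ∑ x ∈ B, fnorm τ (F x) ^ 2 := by
        have : (c ^ j) ^ 2 * ((L : ℝ) ^ d) ^ j = (((L : ℝ) ^ d) ^ j)⁻¹ := by
          rw [sq, mul_assoc, hcj, mul_one, hc, inv_pow]
        rw [← this, hB]
        ring

end Locality

/-! ## §2  The comparison on the period cell -/

section Cell

variable {P L : ℕ} [NeZero P] [NeZero L] {η : ℝ} {U₀ : Site d → Fin d → 𝔸ˣ} {θ : ℝ} {m : ℕ} {a : ℕ → ℝ} {Λs : ℕ → Set (Site d)}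

include hτp hτs in
/-- ★★ **THE GRADIENT COMPARISON ON THE CELL**: for a periodic `f` and a background with `‖R(U₀(b))a − a‖_τ ≤ θη‖a‖_τ` on every bond (`η > 0`),
`Σ_μ Σ_{x∈[0,P)ᵈ} |D^η_{1,μ}f(x)|²_τ ≤ 2·Σ_μ Σ_{x∈[0,P)ᵈ} |D^η_{U₀,μ}f(x)|²_τ + 2dθ²·⟨f, f⟩_{T_P}` (pointwise `|D_1f|² ≤ 2|D_{U₀}f|² + 2θ²|f(x+e_μ)|²`, and the shifted cell
sum of a periodic function is the cell sum). [cite: Balaban1985BackgroundPropagators, (3.23) p.394, (3.86) p.407; Balaban1985RegularSpaces, p.77 («Ω_j = T_η»)] -/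
theorem gradEnergy_one_le_per (hη : 0 < η) (hR : ∀ (x : Site d) (μ : Fin d) (b : 𝔸), fnorm τ (conjR (U₀ x μ) b - b) ≤ θ * η * fnorm τ b)
    (f : perSub (𝔸 := 𝔸) (d := d) P) :
    ∑ μ : Fin d, ∑ x ∈ box (d := d) P, fnorm τ (covDerivFwd η (1 : Site d → Fin d → 𝔸ˣ) μ (f : Site d → 𝔸) x) ^ 2 ≤
      2 * ∑ μ : Fin d, ∑ x ∈ box (d := d) P, fnorm τ (covDerivFwd η U₀ μ (f : Site d → 𝔸) x) ^ 2 + 2 * d * θ ^ 2 * formPer τ P f f := by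
  set F : Site d → 𝔸 := (f : Site d → 𝔸) with hF
  have hff : formPer τ P f f = ∑ x ∈ box (d := d) P, fnorm τ (F x) ^ 2 := by
    rw [formPer_apply]
    exact Finset.sum_congr rfl fun x _ => (fnorm_sq hτp _).symm
  have hdir : ∀ μ : Fin d, ∑ x ∈ box (d := d) P, fnorm τ (covDerivFwd η (1 : Site d → Fin d → 𝔸ˣ) μ F x) ^ 2 ≤
      2 * ∑ x ∈ box (d := d) P, fnorm τ (covDerivFwd η U₀ μ F x) ^ 2 + 2 * θ ^ 2 * formPer τ P f f := by
    intro μ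
    have hshift : ∑ x ∈ box (d := d) P, fnorm τ (F (x + e μ)) ^ 2 = ∑ x ∈ box (d := d) P, fnorm τ (F x) ^ 2 :=
      sum_box_shift P (g := fun x => fnorm τ (F x) ^ 2) (fun x n => congrArg (fun b : 𝔸 => fnorm τ b ^ 2) (f.2 x n)) (e μ)
    calc ∑ x ∈ box (d := d) P, fnorm τ (covDerivFwd η (1 : Site d → Fin d → 𝔸ˣ) μ F x) ^ 2
        ≤ ∑ x ∈ box (d := d) P, (2 * fnorm τ (covDerivFwd η U₀ μ F x) ^ 2 + 2 * θ ^ 2 * fnorm τ (F (x + e μ)) ^ 2) :=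
          Finset.sum_le_sum fun x _ => fnorm_covDerivFwd_one_sq_le τ hτp hτs hη hR F μ x
      _ = 2 * ∑ x ∈ box (d := d) P, fnorm τ (covDerivFwd η U₀ μ F x) ^ 2 + 2 * θ ^ 2 * formPer τ P f f := by
          rw [Finset.sum_add_distrib, ← Finset.mul_sum, ← Finset.mul_sum, hshift, hff]
  calc ∑ μ : Fin d, ∑ x ∈ box (d := d) P, fnorm τ (covDerivFwd η (1 : Site d → Fin d → 𝔸ˣ) μ F x) ^ 2
      ≤ ∑ μ : Fin d, (2 * ∑ x ∈ box (d := d) P, fnorm τ (covDerivFwd η U₀ μ F x) ^ 2 + 2 * θ ^ 2 * formPer τ P f f) := Finset.sum_le_sum fun μ _ => hdir μ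
    _ = 2 * ∑ μ : Fin d, ∑ x ∈ box (d := d) P, fnorm τ (covDerivFwd η U₀ μ F x) ^ 2 + 2 * d * θ ^ 2 * formPer τ P f f := by
        rw [Finset.sum_add_distrib, ← Finset.mul_sum, Finset.sum_const, Finset.card_univ, Fintype.card_fin, nsmul_eq_mul]
        ring

include hτp hτt hτs in
omit [NeZero P] in
/-- ★★ **THE AVERAGING COMPARISON ON THE CELL** (`Lᵐ ∣ P`: for every `j ≤ m` the level-`j` blocks tile the cell, so the block sums of `|f|²` add up to `⟨f, f⟩_{T_P}`):
with weights `a ≥ 0`, unitary tower-pair transporters `ε_i`-close to `1` (`i < m`) and `a_j·(Lᵈ)^{−j}(Σ_{i<j} ε_i)² ≤ κ` (`j ≤ m`),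
`Σ_{j≤m} Σ_{y∈[0,P∕Lʲ)ᵈ} 𝟙_{Λ_j} a_j|(Q′_j(1)f)(y)|² ≤ 2·Σ_{j≤m} Σ_y 𝟙_{Λ_j} a_j|(Q′_j(U₀)f)(y)|² + 2κ(m+1)·⟨f, f⟩_{T_P}`.
[cite: Balaban1985BackgroundPropagators, (3.18)–(3.19) p.393, (3.24) p.394; Balaban1985Averaging, (122)–(126) p.36; Balaban1985RegularSpaces, p.77] -/
theorem penalty_one_le_per (ha : ∀ j, 0 ≤ a j) (hP : L ^ m ∣ P) {ε : ℕ → ℝ} (hε : ∀ i, 0 ≤ ε i)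
    (hT : ∀ i, i < m → ∀ z y : Site d, bgT L U₀ i z y ∈ unitaryUnits 𝔸)
    (hTε : ∀ i, i < m → ∀ (w : Site d) (b : 𝔸), fnorm τ (conjR (bgT L U₀ i (blockMap L w) w) b - b) ≤ ε i * fnorm τ b)
    {κ : ℝ} (hκ0 : 0 ≤ κ) (hκ : ∀ j ∈ Finset.range (m + 1), a j * ((((L : ℝ) ^ d) ^ j)⁻¹ * (∑ i ∈ Finset.range j, ε i) ^ 2) ≤ κ)
    (f : perSub (𝔸 := 𝔸) (d := d) P) :
    ∑ j ∈ Finset.range (m + 1), ∑ y ∈ box (d := d) (P / L ^ j),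
        (Λs j).indicator (fun y => a j * fnorm τ (QprimeIter (zdBlocking d L) (bgT L (1 : Site d → Fin d → 𝔸ˣ)) j (f : Site d → 𝔸) y) ^ 2) y ≤
      2 * ∑ j ∈ Finset.range (m + 1), ∑ y ∈ box (d := d) (P / L ^ j),
          (Λs j).indicator (fun y => a j * fnorm τ (QprimeIter (zdBlocking d L) (bgT L U₀) j (f : Site d → 𝔸) y) ^ 2) y +
        2 * κ * (m + 1) * formPer τ P f f := by
  classical
  set F : Site d → 𝔸 := (f : Site d → 𝔸) with hF
  have hff : formPer τ P f f = ∑ x ∈ box (d := d) P, fnorm τ (F x) ^ 2 := by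
    rw [formPer_apply]
    exact Finset.sum_congr rfl fun x _ => (fnorm_sq hτp _).symm
  have hffnn : 0 ≤ formPer τ P f f := by rw [hff]; exact Finset.sum_nonneg fun _ _ => sq_nonneg _
  -- per level: the block sums tile the cell
  have htile : ∀ j ∈ Finset.range (m + 1), ∑ y ∈ box (d := d) (P / L ^ j), ∑ x ∈ blockSites (L ^ j) y, fnorm τ (F x) ^ 2 = formPer τ P f f := by
    intro j hj
    have hjm : j ≤ m := Nat.lt_succ_iff.1 (Finset.mem_range.1 hj)
    haveI : NeZero (L ^ j) := ⟨pow_ne_zero j (NeZero.ne L)⟩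
    rw [hff, eq_pow_mul_div_of_dvd hP hjm, box_mul_eq_biUnion_blockSites (L ^ j) (P / L ^ j),
      Finset.sum_biUnion (pairwiseDisjoint_blockSites (L ^ j) _), Nat.mul_div_cancel_left _ (pow_pos (Nat.pos_of_ne_zero (NeZero.ne L)) j)]
  -- per point
  have hpt : ∀ j ∈ Finset.range (m + 1), ∀ y : Site d,
      (Λs j).indicator (fun y => a j * fnorm τ (QprimeIter (zdBlocking d L) (bgT L (1 : Site d → Fin d → 𝔸ˣ)) j F y) ^ 2) y ≤
        2 * (Λs j).indicator (fun y => a j * fnorm τ (QprimeIter (zdBlocking d L) (bgT L U₀) j F y) ^ 2) y +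
          2 * κ * ∑ x ∈ blockSites (L ^ j) y, fnorm τ (F x) ^ 2 := by
    intro j hj y
    have hjm : j ≤ m := Nat.lt_succ_iff.1 (Finset.mem_range.1 hj)
    have hS : 0 ≤ ∑ x ∈ blockSites (L ^ j) y, fnorm τ (F x) ^ 2 := Finset.sum_nonneg fun _ _ => sq_nonneg _
    by_cases hy : y ∈ Λs j
    · rw [Set.indicator_of_mem hy, Set.indicator_of_mem hy]
      have h1 := fnorm_sq_le_two_mul_add τ hτp hτs (QprimeIter (zdBlocking d L) (bgT L (1 : Site d → Fin d → 𝔸ˣ)) j F y)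
        (QprimeIter (zdBlocking d L) (bgT L U₀) j F y)
      rw [← neg_sub, fnorm_neg'] at h1
      have h2 := fnorm_QprimeIter_sub_one_sq_le_fun τ hτp hτt hτs hε F (j := j) (fun i hi => hT i (lt_of_lt_of_le hi hjm))
        (fun i hi => hTε i (lt_of_lt_of_le hi hjm)) y (U₀ := U₀)
      have h3 : a j * fnorm τ (QprimeIter (zdBlocking d L) (bgT L U₀) j F y -
          QprimeIter (zdBlocking d L) (bgT L (1 : Site d → Fin d → 𝔸ˣ)) j F y) ^ 2 ≤ κ * ∑ x ∈ blockSites (L ^ j) y, fnorm τ (F x) ^ 2 := by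
        calc a j * fnorm τ _ ^ 2 ≤ a j * ((((L : ℝ) ^ d) ^ j)⁻¹ * (∑ i ∈ Finset.range j, ε i) ^ 2 * ∑ x ∈ blockSites (L ^ j) y, fnorm τ (F x) ^ 2) :=
              mul_le_mul_of_nonneg_left h2 (ha j)
          _ = a j * ((((L : ℝ) ^ d) ^ j)⁻¹ * (∑ i ∈ Finset.range j, ε i) ^ 2) * ∑ x ∈ blockSites (L ^ j) y, fnorm τ (F x) ^ 2 := by ring
          _ ≤ κ * ∑ x ∈ blockSites (L ^ j) y, fnorm τ (F x) ^ 2 := mul_le_mul_of_nonneg_right (hκ j hj) hS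
      nlinarith [mul_le_mul_of_nonneg_left h1 (ha j), h3, ha j]
    · rw [Set.indicator_of_notMem hy, Set.indicator_of_notMem hy]
      nlinarith [hS, hκ0]
  -- sum over the levels and the level cells
  calc ∑ j ∈ Finset.range (m + 1), ∑ y ∈ box (d := d) (P / L ^ j),
          (Λs j).indicator (fun y => a j * fnorm τ (QprimeIter (zdBlocking d L) (bgT L (1 : Site d → Fin d → 𝔸ˣ)) j F y) ^ 2) y
      ≤ ∑ j ∈ Finset.range (m + 1), ∑ y ∈ box (d := d) (P / L ^ j),
          (2 * (Λs j).indicator (fun y => a j * fnorm τ (QprimeIter (zdBlocking d L) (bgT L U₀) j F y) ^ 2) y +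
            2 * κ * ∑ x ∈ blockSites (L ^ j) y, fnorm τ (F x) ^ 2) :=
        Finset.sum_le_sum fun j hj => Finset.sum_le_sum fun y _ => hpt j hj y
    _ = 2 * ∑ j ∈ Finset.range (m + 1), ∑ y ∈ box (d := d) (P / L ^ j),
            (Λs j).indicator (fun y => a j * fnorm τ (QprimeIter (zdBlocking d L) (bgT L U₀) j F y) ^ 2) y +
          2 * κ * ∑ j ∈ Finset.range (m + 1), ∑ y ∈ box (d := d) (P / L ^ j), ∑ x ∈ blockSites (L ^ j) y, fnorm τ (F x) ^ 2 := by
        simp only [Finset.sum_add_distrib, Finset.mul_sum]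
    _ = 2 * ∑ j ∈ Finset.range (m + 1), ∑ y ∈ box (d := d) (P / L ^ j),
            (Λs j).indicator (fun y => a j * fnorm τ (QprimeIter (zdBlocking d L) (bgT L U₀) j F y) ^ 2) y +
          2 * κ * (m + 1) * formPer τ P f f := by
        rw [Finset.sum_congr rfl htile, Finset.sum_const, Finset.card_range, nsmul_eq_mul]
        push_cast
        ring

include hτp hτt hτs in
/-- ★★★ **THE NEAR-FLAT FORM COMPARISON ON `L²(T_P)`**: at a UNITARY `P`-periodic background `U₀` with `‖R(U₀(b))a − a‖_τ ≤ θη‖a‖_τ` on every bond, averaged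
transporters unitary up to level `m` whose tower pairs are `ε_i`-close to `1` (`i < m`), `Lᵐ ∣ P`, weights `a ≥ 0` with `a_j(Lᵈ)^{−j}(Σ_{i<j}ε_i)² ≤ κ`, tracial Hermitian
faithful `τ`: for every `f ∈ L²(T_P, ·)`, `⟨f, Δ′_a(1)f⟩_{T_P} ≤ 2⟨f, Δ′_a(U₀)f⟩_{T_P} + 2(dθ² + κ(m+1))⟨f, f⟩_{T_P}`.
[cite: Balaban1985BackgroundPropagators, (3.23)–(3.24) p.394, (3.86) p.407, Thm 3.11 p.416; Balaban1985Averaging, (122)–(126) p.36; Balaban1985RegularSpaces, p.77] -/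
theorem formPer_deltaPrimeAPer_one_le_near_flat (hη : 0 < η) (hUu : ∀ (x : Site d) (κ' : Fin d), U₀ x κ' ∈ unitaryUnits 𝔸) (hU : IsPeriodic P U₀)
    (hR : ∀ (x : Site d) (μ : Fin d) (b : 𝔸), fnorm τ (conjR (U₀ x μ) b - b) ≤ θ * η * fnorm τ b)
    (ha : ∀ j, 0 ≤ a j) (hP : L ^ m ∣ P) {ε : ℕ → ℝ} (hε : ∀ i, 0 ≤ ε i)
    (hTu : ∀ j, j ≤ m → ∀ (z y : Site d), bgT L U₀ j z y ∈ unitaryUnits 𝔸)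
    (hTε : ∀ i, i < m → ∀ (w : Site d) (b : 𝔸), fnorm τ (conjR (bgT L U₀ i (blockMap L w) w) b - b) ≤ ε i * fnorm τ b)
    {κ : ℝ} (hκ0 : 0 ≤ κ) (hκ : ∀ j ∈ Finset.range (m + 1), a j * ((((L : ℝ) ^ d) ^ j)⁻¹ * (∑ i ∈ Finset.range j, ε i) ^ 2) ≤ κ)
    (f : perSub (𝔸 := 𝔸) (d := d) P) :
    formPer τ P f (deltaPrimeAPer L (1 : Site d → Fin d → 𝔸ˣ) η m a Λs P f) ≤
      2 * formPer τ P f (deltaPrimeAPer L U₀ η m a Λs P f) + 2 * (d * θ ^ 2 + κ * (m + 1)) * formPer τ P f f := by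
  have hU1 : ∀ (x : Site d) (κ' : Fin d), (1 : Site d → Fin d → 𝔸ˣ) x κ' ∈ unitaryUnits 𝔸 := fun _ _ => (unitaryUnits 𝔸).one_mem
  have hT1 : ∀ j, j ≤ m → ∀ (z y : Site d), bgT L (1 : Site d → Fin d → 𝔸ˣ) j z y ∈ unitaryUnits 𝔸 := fun j _ z y => by
    rw [bgT_one]; exact (unitaryUnits 𝔸).one_mem
  have hper1 : IsPeriodic P (1 : Site d → Fin d → 𝔸ˣ) := fun _ _ => rfl
  -- both forms as «gradient energy + penalty» with `fnorm` squares
  have hsq : ∀ (V : Site d → Fin d → 𝔸ˣ) (hV : ∀ (x : Site d) (κ' : Fin d), V x κ' ∈ unitaryUnits 𝔸)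
      (hVT : ∀ j, j ≤ m → ∀ (z y : Site d), bgT L V j z y ∈ unitaryUnits 𝔸) (hVp : IsPeriodic P V),
      formPer τ P f (deltaPrimeAPer L V η m a Λs P f) =
        (∑ μ : Fin d, ∑ x ∈ box (d := d) P, fnorm τ (covDerivFwd η V μ (f : Site d → 𝔸) x) ^ 2) +
          ∑ j ∈ Finset.range (m + 1), ∑ y ∈ box (d := d) (P / L ^ j),
            (Λs j).indicator (fun y => a j * fnorm τ (QprimeIter (zdBlocking d L) (bgT L V) j (f : Site d → 𝔸) y) ^ 2) y := by
    intro V hV hVT hVp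
    rw [formPer_deltaPrimeAPer_le τ hτt hV hVT hVp hP f f]
    congr 1
    · exact Finset.sum_congr rfl fun μ _ => Finset.sum_congr rfl fun x _ => (fnorm_sq hτp _).symm
    · refine Finset.sum_congr rfl fun j _ => Finset.sum_congr rfl fun y _ => ?_
      by_cases hy : y ∈ Λs j
      · rw [Set.indicator_of_mem hy, Set.indicator_of_mem hy, ← fnorm_sq hτp]
      · rw [Set.indicator_of_notMem hy, Set.indicator_of_notMem hy]
  rw [hsq 1 hU1 hT1 hper1, hsq U₀ hUu hTu hU]
  have hG := gradEnergy_one_le_per τ hτp hτs hη hR f (P := P)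
  have hQ := penalty_one_le_per τ hτp hτt hτs ha hP hε (fun i hi z y => hTu i hi.le z y) hTε hκ0 hκ f (Λs := Λs)
  nlinarith [hG, hQ]

end Cell

/-! ## §3  Transfer of the flat coercivity: the scalar regime on an explicit small-field class of the torus -/

section Transfer

variable {P L : ℕ} [NeZero P] [NeZero L] {η : ℝ} {U₀ : Site d → Fin d → 𝔸ˣ} {θ : ℝ} {m : ℕ} {a : ℕ → ℝ} {Λs : ℕ → Set (Site d)}

include hτp hτt hτs in
/-- ★★★ **NEAR-FLAT COERCIVITY ON THE TORUS FROM THE FLAT ONE**: under the hypotheses of `formPer_deltaPrimeAPer_one_le_near_flat`, a flat coercivity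
`a₀·⟨f,f⟩ ≤ ⟨f, Δ′_a(1)f⟩` on `L²(T_P)` (e.g. `B9Thm31FlatPoincareCoerciveZdPer.formPer_deltaPrimeAPer_one_coercive`) transfers:
`(a₀∕2 − dθ² − κ(m+1))·⟨f, f⟩_{T_P} ≤ ⟨f, Δ′_a(U₀)f⟩_{T_P}`. [cite: Balaban1985BackgroundPropagators, Thm 3.11 p.416 («uniformly in U»), (3.24) p.394, (3.35) p.396] -/
theorem coercive_near_flat_per (hη : 0 < η) (hUu : ∀ (x : Site d) (κ' : Fin d), U₀ x κ' ∈ unitaryUnits 𝔸) (hU : IsPeriodic P U₀)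
    (hR : ∀ (x : Site d) (μ : Fin d) (b : 𝔸), fnorm τ (conjR (U₀ x μ) b - b) ≤ θ * η * fnorm τ b)
    (ha : ∀ j, 0 ≤ a j) (hP : L ^ m ∣ P) {ε : ℕ → ℝ} (hε : ∀ i, 0 ≤ ε i)
    (hTu : ∀ j, j ≤ m → ∀ (z y : Site d), bgT L U₀ j z y ∈ unitaryUnits 𝔸)
    (hTε : ∀ i, i < m → ∀ (w : Site d) (b : 𝔸), fnorm τ (conjR (bgT L U₀ i (blockMap L w) w) b - b) ≤ ε i * fnorm τ b)
    {κ : ℝ} (hκ0 : 0 ≤ κ) (hκ : ∀ j ∈ Finset.range (m + 1), a j * ((((L : ℝ) ^ d) ^ j)⁻¹ * (∑ i ∈ Finset.range j, ε i) ^ 2) ≤ κ)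
    {a₀ : ℝ} (hco : ∀ f : perSub (𝔸 := 𝔸) (d := d) P, a₀ * formPer τ P f f ≤ formPer τ P f (deltaPrimeAPer L (1 : Site d → Fin d → 𝔸ˣ) η m a Λs P f))
    (f : perSub (𝔸 := 𝔸) (d := d) P) :
    (a₀ / 2 - d * θ ^ 2 - κ * (m + 1)) * formPer τ P f f ≤ formPer τ P f (deltaPrimeAPer L U₀ η m a Λs P f) := by
  have h1 := hco f
  have h2 := formPer_deltaPrimeAPer_one_le_near_flat τ hτp hτt hτs hη hUu hU hR ha hP hε hTu hTε hκ0 hκ f (Λs := Λs)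
  nlinarith [h1, h2]

include hτp hτt hτs in
/-- ★★ **THE SCALAR REGIME ON AN EXPLICIT SMALL-FIELD CLASS OF THE TORUS**: if moreover `dθ² + κ(m+1) < a₀∕2`, then `Δ′_a(U₀)` is positive definite and INVERTIBLE on
`L²(T_P)` (`RegularPrimePer`) at every such `U₀`. [cite: Balaban1985BackgroundPropagators, Thm 3.11 p.416, (3.24) p.394 («Its inverse is denoted by G′»), (3.35) p.396] -/
theorem regularPrimePer_near_flat [FiniteDimensional ℝ 𝔸] (hη : 0 < η) (hUu : ∀ (x : Site d) (κ' : Fin d), U₀ x κ' ∈ unitaryUnits 𝔸) (hU : IsPeriodic P U₀)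
    (hR : ∀ (x : Site d) (μ : Fin d) (b : 𝔸), fnorm τ (conjR (U₀ x μ) b - b) ≤ θ * η * fnorm τ b)
    (ha : ∀ j, 0 ≤ a j) (hP : L ^ m ∣ P) {ε : ℕ → ℝ} (hε : ∀ i, 0 ≤ ε i)
    (hTu : ∀ j, j ≤ m → ∀ (z y : Site d), bgT L U₀ j z y ∈ unitaryUnits 𝔸)
    (hTε : ∀ i, i < m → ∀ (w : Site d) (b : 𝔸), fnorm τ (conjR (bgT L U₀ i (blockMap L w) w) b - b) ≤ ε i * fnorm τ b)
    {κ : ℝ} (hκ0 : 0 ≤ κ) (hκ : ∀ j ∈ Finset.range (m + 1), a j * ((((L : ℝ) ^ d) ^ j)⁻¹ * (∑ i ∈ Finset.range j, ε i) ^ 2) ≤ κ)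
    {a₀ : ℝ} (hco : ∀ f : perSub (𝔸 := 𝔸) (d := d) P, a₀ * formPer τ P f f ≤ formPer τ P f (deltaPrimeAPer L (1 : Site d → Fin d → 𝔸ˣ) η m a Λs P f))
    (hmargin : d * θ ^ 2 + κ * (m + 1) < a₀ / 2) :
    RegularPrimePer L U₀ η m a Λs P := by
  refine bijective_of_form_pos τ fun f hf => lt_of_lt_of_le ?_
    (coercive_near_flat_per τ hτp hτt hτs hη hUu hU hR ha hP hε hTu hTε hκ0 hκ hco f)
  have hnn : 0 ≤ formPer τ P f f := by
    rw [formPer_apply]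
    exact Finset.sum_nonneg fun x _ => by rw [← fnorm_sq hτp]; exact sq_nonneg _
  have hpos : 0 < formPer τ P f f := by
    rcases hnn.lt_or_eq with h | h
    · exact h
    · exact absurd (B9Eq321LandauProjectionZdPer.formPer_apply_self_eq_zero τ P hτp h.symm) hf
  exact mul_pos (by linarith) hpos

end Transfer

end Literature.MathematicalPhysics.QuantumFieldTheory.Balaban1983to89.B9Eq324NearFlatFormComparisonZdPer

end
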